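import Summits.QuantumFields.YangMills.Theorems.BalabanUVNodesK0AxRootGradCalc

/-!
# NODE O · K0ᴬ — THE P0 JUNCTION SOCKET «ROOTING IS A GRADIENT AT FIRST ORDER»: the receipts (C-wcg) ∕ (C-orb) ∕ (C-crit) ∕ (C-cons) of the ROOTED response
# `recordD` TRANSFER VERBATIM to the response of ANY chart `U(B)` with `recordBgField = rootGauge ∘ U` near `B = 0`; instantiated at node00-def-Y's `BgScheme.chartCfg`

LANDING NOTE (porter ▶ PTC-1 g4, 2026-08-31; AUTHORSHIP = ◇ lens-1 g11 «cauchy-analytic», HOME sketch `nodeO-cover/LENS-1g11-JunctionRootGrad-v1.lean` sha16 ef4e791fbbd67beb · 544 l. · 6 def + 23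
thm · 0 sorry): the HOME file exceeds the gate's 400-line cap, so it is landed as THREE files by a MECHANICAL split (◇ lens-1 g11's OPTION (b) three-file variant, nodeO STATUS 11:07:50Z; generator
`work/gen/build_split_rootgrad3.py` of this seat; docstrings, statements and proofs BYTE-IDENTICAL to the HOME sketch; imports as the monolith): FILE 1
`…Theorems/BalabanUVNodesK0AxRootGradCalc.lean` = header + §1 (ns `K0AxRootGrad`: generic calculus of the rooted gauge at the unit configuration), FILE 2
`…Theorems/BalabanUVNodesK0AxJunctionRootGrad.lean` = header + `import …K0AxRootGradCalc` + §2 (ns `K0AxCtabUniq`: `chartRespD`, the displayed chart-level letters, rooted ⟺ chart transfer of the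
receipts), FILE 3 `…Theorems/BalabanUVNodesK0AxJunctionRootGradScheme.lean` = header + `import …K0AxJunctionRootGrad` + §2's namespace∕`open`∕`variable` preamble + §3 (`section Scheme`: the def-Y
`BgScheme` ∕ KNIT instances). THIS IS FILE 2 OF 3 (the others: `…K0AxRootGradCalc` ∕ `…K0AxJunctionRootGradScheme`).  Landed on ◇ lens-1 g11's CANDIDATE 1 (nodeO STATUS 11:05:04Z), after ✓p820208
`…K0AxCtabOrbitIffCrit` (B-5) and node00-def-Y's ✓`…N07P0FixedPointIsRecordMinimiserAtChart`; ◆ CRIT-1 g37's cut + J1′∕J4∕J5′ stamp: SAME-WALL verdict SURVIVES (PRICED); CUT = GO THREE-FILE (b) AS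
STAGED (INTENT-53∕54∕55); J1′ ∕ J4 ∕ J5′ ∕ (Q-ord) ∕ (Q-bridge) PASS; axioms standard on ◆'s monolith run; price displayed: (p1) `ChartResponseWeaklyCriticalAt` at def-Y's chart — print's
statement ONLY for a scheme whose `bg` is the CONSTANT flat `U₀` and whose chart is the (21)-Landau-gauge representative ([15] §G p.305, (174)–(178)); def-Y's `bgSchemeOfRecord` qualifies, for any
other representative of the orbit `chartRespD` shifts by a gradient and (p1) runs into the STRUCK (C-tab-opt) wall — plus (p2) factorisation tokens, (p3) `chartCfg 1 = 1` ∕ C² chart entries, (p4)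
range guard, and the two flat dictionaries (J-crit)∕(J-cons), all OPEN (nodeO STATUS 2026-08-31T11:13:06Z); helper `--supports stmt-QuantumFields-27238 --as helper` (NO `--workitem`).  HONEST
(porter): calculus of finite matrix products + bookkeeping; CONDITIONAL theorems over DISPLAYED letters (`RootFactorAt`, `ChartRegAt`, `ChartResponseWeaklyCriticalAt`, def-Y∕KNIT tokens — all
OPEN, asserted nowhere); (C-tab-opt) stays STRUCK; nothing of Bałaban asserted, ported, discharged or refuted; K0ᴬ stmt-QuantumFields-27238 ∕ K0⁷ 20541 OPEN — NOTHING of them proved; NODE O 0∕1;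
COUNT 8∕28 · K 1∕4 UNMOVED; finite 𝕋⁴ at fixed ε — NOT continuum ∕ OS ∕ Clay; the Yang–Mills mass gap is NOT proved by any of this.

◇ `ymgap-nodeO-lens-1` g11 (planner; typed for the porter ▶ PTC-1; proposed basename `…/Theorems/BalabanUVNodesK0AxJunctionRootGrad.lean`,
`--supports stmt-QuantumFields-27238 --as helper`).  Items: K0ᴬ stmt-QuantumFields-27238 OPEN; K0⁷ stmt-QuantumFields-20541 OPEN.  [15] = [Balaban1985Variational],
[I] = [Balaban1987RG1], [B6] = [Balaban1984PropagatorsII].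

WHY.  After B-5 (✓`…K0AxCtabOrbitIffCrit`) the one displayed NON-P0-token leaf of the (R-a) road is (C-orb) ⟺ (C-wcg) ⟺ (C-crit) ∧ (C-cons), all stated on the ROOTED
table `recordD := D|₀ (entries of UkSel F 2 K (k+1) εbg (unitField B))`.  Their supplier is P0 = node00-def-Y's `BgScheme` ([15] Prop. 6 ∕ Thm 1 as a named map:
✓`Node00.BackgroundMapOfRecord`, ✓`…BgSchemeOfRecordC`, (s2) `…BgSchemeOfRecordEL`), which speaks of the CHART IMAGE `chartCfg S V` of the (116)-fixed point, while the
selector adds the ROOTED GAUGE: ✓`UkSel_eq_rootGauge_chartCfg_of_orbitRel` («`UkSel V = rootGauge (chartCfg S V)`» under the (11′)-tokens).  The seam (◆ Q-27: «the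
real-side identification `recordBgField = chart ∘ …` is in NO file») is closed here by ONE calculus fact: at the unit configuration the rooted gauge `U ↦ U^{g_U}`
(`T4RootedResidualGauge.rootGauge`, `g_U(x)` = holonomy along the coordinate path from the block root) has derivative `Y ↦ Y + (Ψ(b₋) − Ψ(b₊))`, `Ψ := D g(1)`, i.e.
ROOTING CONTRIBUTES A PURE (unrestricted) GRADIENT — and every receipt of the road is a statement MODULO unrestricted gradients.  So the receipts for `recordD` are
EQUIVALENT to the same receipts for the chart response `chartRespD U := D|₀ (entries of U(B))`, for ANY factorisation `recordBgField =ᶠ rootGauge (k+1) ∘ U` with `U(0) = 1`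
and differentiable entries; no property of the selector, no Landau representative, no `N(Q′)`-clause is used, and NO identity `recordD = (transverse table)` is stated (J5′).

WHAT IS PROVED (kernel, sorry-free, standard axioms).
§1 (generic, any real normed parameter space `E`, any `Params`): `differentiableAt_coe_lineHol ∕ _pathHol ∕ _rootTransporter` and the `Cⁿ` twins `contDiffAt_coe_lineHol ∕ _pathHol ∕
   _rootGauge` (finite products and adjoints); ★ `hasFDerivAt_coe_rootGauge`:
   if `U e₀ = 1` and the bond matrices of `U e` are differentiable at `e₀`, then `e ↦ (rootGauge k (U e))(b)` has derivative `DU(b) + (Ψ b.src − Ψ b.tgt)` at `e₀` with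
   `Ψ x := D(e ↦ g_{U e}(x))(e₀)` anti-Hermitian-valued (`star (Ψ x v) = −Ψ x v`, from `g ∈ SU(2)`).
§2 (K0 letters, namespace `K0AxCtabUniq`): `chartRespD` (the chart twin of ✓`recordD`); displayed letters `RootFactorAt` (factorisation), `ChartRegAt`, `ChartResponseCriticalModGaugeAt`,
   `ChartResponseWeaklyCriticalAt`; ★★ `recordD_eq_chartRespD_add_grad` (under the factorisation token: `recordD a l b = chartRespD U a l b + (ψ(b₋) − ψ(b₊))`); ★★
   `contDiffAt_recordBgField_entries_of_chart` (TokP9reg♭ᵣ — `Cⁿ` entries of `recordBgField` at `0` — FROM `Cⁿ` chart entries, `n = 2` the displayed letter of ✓`twoVolExp_orbit_images`); ★★ `rootedResponseOrbitAt_iff_chart`, ★★ `criticalModGauge_iff_chart` ((C-orb), (C-wcg) are INVARIANT under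
   the passage rooted ↔ chart); ★★★ `criticalModGauge_of_chart_weaklyCritical`: if the chart response ITSELF is weakly critical (the `φ₀ = 0` shape — legitimate for a chart in
   the (21)-Landau gauge, unlike for the rooted table where it is the STRUCK (C-tab-opt)), then (C-wcg), hence (C-orb) (✓`rootedResponseOrbitAt_of_criticalModGauge`) and
   (C-crit) ∧ (C-cons) (✓`criticalModGauge_iff_invCritical_and_constraintModGauge`).
§3 (the def-Y instance): `ChartMinimiserResTok` (DISPLAYED: the Prop-7 gauge transform of `Prop7Tok` may be taken RESIDUAL of level `k+1` — p. 299 «U_k = (U₁U₀)^u» with `u`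
   the axial∕rooted normaliser); ★★ `eventually_recordBgField_eq_rootGauge_chartCfg` (the factorisation token FROM `UniqTok` + `ChartMinimiserResTok` + «charted fields near
   `B = 0` lie in the (7)-domain», by ✓`UkSel_eq_rootGauge_chartCfg_of_orbitRel`); ★★★ `rootedReceipts_of_bgScheme`: the four receipts (C-wcg) ∕ (C-orb) ∕ (C-crit) ∕ (C-cons)
   for ALL `a l` FROM the displayed scheme-level letters {`UniqTok`, `ChartMinimiserResTok`, domain near flat, `chartCfg S 1 = 1`, differentiable chart entries at `B = 0`,
   chart response weakly critical}, and ★★ `tokP9reg_of_bgScheme` (TokP9reg♭ᵣ from the same tokens + `C²` chart entries) — so EVERY non-D1 leaf of ✓`twoVolExp_orbit_images` is now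
   addressed at scheme level; ★★ `rootFactorAt_of_tokens_chart` ∕ ★★★ `rootedReceipts_of_tokens_chart`: the same with the factorisation supplied by the N07∕P0 KNIT
   (✓`N07P0FixedPointIsRecordMinimiser.ukSel_eq_rootGauge_chartCfg_of_tokens_chart`, dag-n07-w3: tokens (rng)(cov)(c→s)(min) at `S.chart V` + `S.RegimeTok`) instead of
   `UniqTok` + `ChartMinimiserResTok`; ★★★ `rootedReceipts_of_chart`: the four receipts from the three chart-level letters for ANY chart.  The weak-criticality letter is
   exactly what (s2)∕(s3) of node00-def-Y (EL (111) + constraint (109) + Hessian at the flat background) are to deliver,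
   now addressed to the CHART, where print states it ([15] (176)–(178), [B6] (2.35)), and no longer to the selector.

HONEST.  Calculus of finite matrix products + bookkeeping; CONDITIONAL theorems over DISPLAYED letters; nothing of Bałaban ([15] Thm 1, Prop. 6–9, (176)–(178); [B6] (2.35);
[I] (4.35)) is asserted, ported or discharged; (C-tab-opt) stays STRUCK; P0's tokens, D1 ⟨27930⟩, TokP9reg♭, (Tok-cmpU-cap) OPEN; K0ᴬ 27238 ∕ K0⁷ 20541 OPEN — NOTHING of them
proved; NODE O 0∕1; COUNT 8∕28 · K 1∕4 UNMOVED; finite 𝕋⁴_{L^K} at fixed ε — NOT continuum ∕ OS ∕ Clay; **the Yang–Mills mass gap is NOT proved by any of this.**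
No `sorry`, no `instance ∕ notation ∕ set_option`; standard axioms.
-/

noncomputable section

open Filter Topology
open scoped BigOperators Matrix.Norms.L2Operator

/-! ## §2  The K0 junction: receipts of the rooted table ⟺ receipts of the chart table -/

namespace Summit.QuantumFields.YangMills.Theorems.K0AxCtabUniq

open Literature.MathematicalPhysics.QuantumFieldTheory.Balaban1983to89
open LatticeFieldCalculus B6SectADomainsV1 B6SectAOperatorsV1 B6SectAVectorModelV1 B6SectACriticalPointV1
open Literature.MathematicalPhysics.QuantumFieldTheory.Balaban1983to89.T4Continuum (T4Family)
open Literature.MathematicalPhysics.QuantumFieldTheory.Balaban1983to89.Node00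
open T4RootedResidualGauge (rootGauge)
open GaugeField (gaugeAct)
open B12GaugeOrbits021 (IsResidual OrbitRel)
open B11Prop6Scheme (mapT)
open Summit.QuantumFields.YangMills.Theorems.K0RecordFormatNames
open Summit.QuantumFields.YangMills.Theorems.K0AxRootGrad

variable (F : T4Family) (θ : Stage13Params F 2)

/-- **The CHART response entries** `chartRespD F θ k K U a l b i i'`: the twin of ✓`recordD` with the rooted background field replaced by an arbitrary chart `U(B)` of it
(`B ↦` an `SU(2)` configuration of the fine lattice; in §3, node00-def-Y's `chartCfg S (unitField B)` — the chart image of the (116)-fixed point). [cite: Balaban1985Variational, (15) p.280, Prop. 9 p.309; Balaban1987RG1, (4.35) p.290] -/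
def chartRespD (k K : ℕ) (U : (Fin (F.P K).d → Site (F.P K) (k + 1) → θ.Vβ) → GaugeField (F.P K) 0 (SU 2)) (a : θ.ιβ) (l : RespLabel F k K) :
    PBond (F.P K) 0 → Fin 2 → Fin 2 → ℂ :=
  letI := θ.instVβ₁; letI := θ.instVβ₂; letI := θ.instιβ
  fderiv ℝ (fun B : Fin (F.P K).d → Site (F.P K) (k + 1) → θ.Vβ =>
    fun (b : PBond (F.P K) 0) (i i' : Fin 2) => ((U B b : SU 2) : Matrix (Fin 2) (Fin 2) ℂ) i i') 0
    (Pi.single l.1 (Pi.single l.2 (θ.bV a)))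

/-- The chart twin of (C-wcg): for some unrestricted potential `φ₀`, every entry of `ξ⁻¹·(chartRespD U a l − ∂φ₀)` (real ∕ imaginary parts) is weakly critical for the global
linearised problem with datum the matching part of `ρ₈(bV a)_{ii′}·e_l`. DISPLAYED — asserts nothing. [cite: Balaban1985Variational, (176)–(178) p.306; Balaban1984PropagatorsII, (2.35) p.228] -/
def ChartResponseCriticalModGaugeAt (k K : ℕ) (U : (Fin (F.P K).d → Site (F.P K) (k + 1) → θ.Vβ) → GaugeField (F.P K) 0 (SU 2))
    (a : θ.ιβ) (l : RespLabel F k K) : Prop :=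
  letI := θ.instVβ₁; letI := θ.instVβ₂
  ∃ φ₀ : Site (F.P K) 0 → Fin 2 → Fin 2 → ℂ, ∀ hk : k + 1 ≤ (F.P K).m + (F.P K).K, ∀ i i' : Fin 2,
    WeaklyCritical (univDomains F k K hk) 1 ((θ.ρ8 (θ.bV a) i i').re • windowSrc F k K hk Finset.univ l)
        (reBond F K fun b => (((F.P K).eta (k + 1))⁻¹ : ℂ) * (chartRespD F θ k K U a l b i i' - (φ₀ b.tgt i i' - φ₀ b.src i i'))) ∧
      WeaklyCritical (univDomains F k K hk) 1 ((θ.ρ8 (θ.bV a) i i').im • windowSrc F k K hk Finset.univ l)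
        (imBond F K fun b => (((F.P K).eta (k + 1))⁻¹ : ℂ) * (chartRespD F θ k K U a l b i i' - (φ₀ b.tgt i i' - φ₀ b.src i i')))

/-- The chart-level `φ₀ = 0` letter: the chart response ITSELF is weakly critical, entry by entry (the shape print gives the response of the (21)-Landau-gauge chart,
[15] (176)–(178) + [B6] (2.35); for the ROOTED table this shape is the STRUCK (C-tab-opt)). DISPLAYED — asserts nothing. [cite: Balaban1985Variational, (176)–(178) p.306, (21) p.281; Balaban1984PropagatorsII, (2.35) p.228] -/
def ChartResponseWeaklyCriticalAt (k K : ℕ) (U : (Fin (F.P K).d → Site (F.P K) (k + 1) → θ.Vβ) → GaugeField (F.P K) 0 (SU 2))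
    (a : θ.ιβ) (l : RespLabel F k K) : Prop :=
  letI := θ.instVβ₁; letI := θ.instVβ₂
  ∀ hk : k + 1 ≤ (F.P K).m + (F.P K).K, ∀ i i' : Fin 2,
    WeaklyCritical (univDomains F k K hk) 1 ((θ.ρ8 (θ.bV a) i i').re • windowSrc F k K hk Finset.univ l)
        (reBond F K fun b => (((F.P K).eta (k + 1))⁻¹ : ℂ) * chartRespD F θ k K U a l b i i') ∧
      WeaklyCritical (univDomains F k K hk) 1 ((θ.ρ8 (θ.bV a) i i').im • windowSrc F k K hk Finset.univ l)
        (imBond F K fun b => (((F.P K).eta (k + 1))⁻¹ : ℂ) * chartRespD F θ k K U a l b i i')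

/-- **THE FACTORISATION TOKEN** at K0: near `B = 0` the rooted background field of record IS the rooted gauge of the chart `U(B)` (for def-Y's chart: §3,
✓`UkSel_eq_rootGauge_chartCfg_of_orbitRel` under the (11′)-tokens). DISPLAYED — asserts nothing. [cite: Balaban1985Variational, Thm 1 p.279, (19) p.281, p.299] -/
def RootFactorAt (k K : ℕ) (U : (Fin (F.P K).d → Site (F.P K) (k + 1) → θ.Vβ) → GaugeField (F.P K) 0 (SU 2)) : Prop :=
  letI := θ.instVβ₁; letI := θ.instVβ₂
  ∀ᶠ B in 𝓝 (0 : Fin (F.P K).d → Site (F.P K) (k + 1) → θ.Vβ), recordBgField F θ k K B = rootGauge (k + 1) (U B)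

/-- **Differentiable chart entries at `B = 0` with `U(0) = 1`** (for def-Y's chart: [15] §5∕Prop. 9 analyticity of the fixed point, ✓`BgScheme.analyticOnNhd_sol_comp`, +
`ChartSUTok`; the value at `0`: `sol 1 = 0`, `𝔄 1 = 0`, `bg 1 = 1`). DISPLAYED — asserts nothing. [cite: Balaban1985Variational, Prop. 9 p.309, (116) p.295] -/
def ChartRegAt (k K : ℕ) (U : (Fin (F.P K).d → Site (F.P K) (k + 1) → θ.Vβ) → GaugeField (F.P K) 0 (SU 2)) : Prop :=
  letI := θ.instVβ₁; letI := θ.instVβ₂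
  U 0 = 1 ∧ ∀ b : PBond (F.P K) 0, DifferentiableAt ℝ (fun B : Fin (F.P K).d → Site (F.P K) (k + 1) → θ.Vβ => ((U B b : SU 2) : MatA 2)) 0

/-- ★★ **`recordD = chartRespD + ∂ψ`**: under the factorisation token and chart regularity, the rooted response differs from the chart response by the UNRESTRICTED gradient of
the linearised rooting transporter `ψ_{a,l}(x) := D(B ↦ g_{U(B)}(x))(0)·(δ_l ⊗ bV a)` (anti-Hermitian values) — computed, not postulated. [cite: Balaban1985Variational, (19) p.281, (176)–(178) p.306; Balaban1987RG1, (2.3) p.265, (4.35) p.290] -/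
theorem recordD_eq_chartRespD_add_grad (k K : ℕ) (U : (Fin (F.P K).d → Site (F.P K) (k + 1) → θ.Vβ) → GaugeField (F.P K) 0 (SU 2))
    (hfac : RootFactorAt F θ k K U) (hreg : ChartRegAt F θ k K U) (a : θ.ιβ) (l : RespLabel F k K) :
    ∃ ψ : Site (F.P K) 0 → Fin 2 → Fin 2 → ℂ, (∀ x, star (Matrix.of (ψ x)) = -Matrix.of (ψ x)) ∧
      ∀ (b : PBond (F.P K) 0) (i i' : Fin 2),
        recordD F θ k K a l b i i' = chartRespD F θ k K U a l b i i' + (ψ b.src i i' - ψ b.tgt i i') := by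
  letI := θ.instVβ₁; letI := θ.instVβ₂; letI := θ.instιβ
  obtain ⟨hU0, hUd⟩ := hreg
  obtain ⟨Ψ, hΨstar, hΨ⟩ := hasFDerivAt_coe_rootGauge (k + 1) U hU0 hUd
  set v : Fin (F.P K).d → Site (F.P K) (k + 1) → θ.Vβ := Pi.single l.1 (Pi.single l.2 (θ.bV a)) with hv
  refine ⟨fun x i i' => Ψ x v i i', fun x => ?_, fun b i i' => ?_⟩
  · have : Matrix.of (fun i i' => Ψ x v i i') = Ψ x v := by ext i i'; rfl
    rw [this, hΨstar]
  -- the rooted side: `recordD` through the factorisation (eventual equality ⇒ equal derivatives at 0)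
  have hev : (fun B : Fin (F.P K).d → Site (F.P K) (k + 1) → θ.Vβ =>
        fun (b : PBond (F.P K) 0) (i i' : Fin 2) => ((recordBgField F θ k K B b : SU 2) : Matrix (Fin 2) (Fin 2) ℂ) i i') =ᶠ[𝓝 0]
      (fun B => fun (b : PBond (F.P K) 0) (i i' : Fin 2) => ((rootGauge (k + 1) (U B) b : SU 2) : Matrix (Fin 2) (Fin 2) ℂ) i i') :=
    hfac.mono fun B hB => by simp only [hB]
  have hpiR : HasFDerivAt (fun B : Fin (F.P K).d → Site (F.P K) (k + 1) → θ.Vβ => fun b : PBond (F.P K) 0 =>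
        ((rootGauge (k + 1) (U B) b : SU 2) : MatA 2))
      (ContinuousLinearMap.pi fun b : PBond (F.P K) 0 =>
        fderiv ℝ (fun B : Fin (F.P K).d → Site (F.P K) (k + 1) → θ.Vβ => ((U B b : SU 2) : MatA 2)) 0 + (Ψ b.src - Ψ b.tgt)) 0 :=
    hasFDerivAt_pi.2 fun b => hΨ b
  have hpiU : HasFDerivAt (fun B : Fin (F.P K).d → Site (F.P K) (k + 1) → θ.Vβ => fun b : PBond (F.P K) 0 => ((U B b : SU 2) : MatA 2))
      (ContinuousLinearMap.pi fun b : PBond (F.P K) 0 =>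
        fderiv ℝ (fun B : Fin (F.P K).d → Site (F.P K) (k + 1) → θ.Vβ => ((U B b : SU 2) : MatA 2)) 0) 0 :=
    hasFDerivAt_pi.2 fun b => (hUd b).hasFDerivAt
  have hR := fderiv_entries_apply (fun B : Fin (F.P K).d → Site (F.P K) (k + 1) → θ.Vβ => fun b : PBond (F.P K) 0 =>
      ((rootGauge (k + 1) (U B) b : SU 2) : MatA 2)) hpiR v b i i'
  have hU := fderiv_entries_apply (fun B : Fin (F.P K).d → Site (F.P K) (k + 1) → θ.Vβ => fun b : PBond (F.P K) 0 =>
      ((U B b : SU 2) : MatA 2)) hpiU v b i i'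
  unfold recordD chartRespD
  rw [hev.fderiv_eq, hR, hU]
  simp only [ContinuousLinearMap.pi_apply, add_apply, sub_apply, Matrix.add_apply, Matrix.sub_apply]

/-- ★★ **TokP9reg♭ FROM THE CHART**: under the factorisation token, `Cⁿ` chart entries at `B = 0` give `Cⁿ` entries of the rooted background field of record at `B = 0`
(the displayed C²-letter TokP9reg♭ᵣ of ✓`K0AxJoinT.twoVolExp_orbit_images` is the case `n = 2`). [cite: Balaban1985Variational, Prop. 9 p.309, (19) p.281; Balaban1987RG1, (4.35) p.290] -/
theorem contDiffAt_recordBgField_entries_of_chart {n : WithTop ℕ∞} (k K : ℕ)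
    (U : (Fin (F.P K).d → Site (F.P K) (k + 1) → θ.Vβ) → GaugeField (F.P K) 0 (SU 2)) (hfac : RootFactorAt F θ k K U)
    (hU : letI := θ.instVβ₁; letI := θ.instVβ₂;
      ∀ b : PBond (F.P K) 0, ContDiffAt ℝ n (fun B : Fin (F.P K).d → Site (F.P K) (k + 1) → θ.Vβ => ((U B b : SU 2) : MatA 2)) 0) :
    letI := θ.instVβ₁; letI := θ.instVβ₂
    ContDiffAt ℝ n (fun B : Fin (F.P K).d → Site (F.P K) (k + 1) → θ.Vβ =>
      fun (b : PBond (F.P K) 0) (i i' : Fin 2) => ((recordBgField F θ k K B b : SU 2) : Matrix (Fin 2) (Fin 2) ℂ) i i') 0 := by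
  letI := θ.instVβ₁; letI := θ.instVβ₂
  have hev : (fun B : Fin (F.P K).d → Site (F.P K) (k + 1) → θ.Vβ =>
        fun (b : PBond (F.P K) 0) (i i' : Fin 2) => ((recordBgField F θ k K B b : SU 2) : Matrix (Fin 2) (Fin 2) ℂ) i i') =ᶠ[𝓝 0]
      (fun B => fun (b : PBond (F.P K) 0) (i i' : Fin 2) => ((rootGauge (k + 1) (U B) b : SU 2) : Matrix (Fin 2) (Fin 2) ℂ) i i') :=
    hfac.mono fun B hB => by simp only [hB]
  have h := contDiffAt_entries (fun B : Fin (F.P K).d → Site (F.P K) (k + 1) → θ.Vβ => fun b : PBond (F.P K) 0 =>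
      ((rootGauge (k + 1) (U B) b : SU 2) : MatA 2)) fun b => contDiffAt_coe_rootGauge (k + 1) U hU b
  exact h.congr_of_eventuallyEq hev

/-- ★★ **(C-orb) is INVARIANT under rooted ↔ chart**: the rooted response lies in the gradient orbit of the whole-torus window response iff the chart response does.
[cite: Balaban1985Variational, (176)–(178) p.306, (19) p.281; Balaban1984PropagatorsII, (2.35) p.228; Balaban1987RG1, (4.35) p.290] -/
theorem rootedResponseOrbitAt_iff_chart (k K : ℕ) (U : (Fin (F.P K).d → Site (F.P K) (k + 1) → θ.Vβ) → GaugeField (F.P K) 0 (SU 2))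
    (hfac : RootFactorAt F θ k K U) (hreg : ChartRegAt F θ k K U) (a : θ.ιβ) (l : RespLabel F k K) :
    RootedResponseOrbitAt F θ k K a l ↔
      ∃ φ : Site (F.P K) 0 → Fin 2 → Fin 2 → ℂ, ∀ (b : PBond (F.P K) 0) (i i' : Fin 2),
        chartRespD F θ k K U a l b i i' - recordHrLocξ F θ k K Finset.univ a l b i i' = φ b.tgt i i' - φ b.src i i' := by
  obtain ⟨ψ, -, hψ⟩ := recordD_eq_chartRespD_add_grad F θ k K U hfac hreg a l
  constructor
  · rintro ⟨φ, hφ⟩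
    refine ⟨fun x i i' => φ x i i' + ψ x i i', fun b i i' => ?_⟩
    have h := hφ b i i'
    rw [hψ b i i'] at h
    linear_combination h
  · rintro ⟨φ, hφ⟩
    refine ⟨fun x i i' => φ x i i' - ψ x i i', fun b i i' => ?_⟩
    have h := hφ b i i'
    rw [hψ b i i']
    linear_combination h

/-- ★★ **(C-wcg) is INVARIANT under rooted ↔ chart** (shift the unrestricted potential by the rooting potential `ψ`). [cite: Balaban1985Variational, (176)–(178) p.306, (19) p.281; Balaban1984PropagatorsII, (2.12) p.225, (2.35) p.228] -/
theorem criticalModGauge_iff_chart (k K : ℕ) (U : (Fin (F.P K).d → Site (F.P K) (k + 1) → θ.Vβ) → GaugeField (F.P K) 0 (SU 2))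
    (hfac : RootFactorAt F θ k K U) (hreg : ChartRegAt F θ k K U) (a : θ.ιβ) (l : RespLabel F k K) :
    RootedResponseCriticalModGaugeAt F θ k K a l ↔ ChartResponseCriticalModGaugeAt F θ k K U a l := by
  letI := θ.instVβ₁; letI := θ.instVβ₂
  obtain ⟨ψ, -, hψ⟩ := recordD_eq_chartRespD_add_grad F θ k K U hfac hreg a l
  have key : ∀ (φ₀ : Site (F.P K) 0 → Fin 2 → Fin 2 → ℂ) (i i' : Fin 2),
      (fun b : PBond (F.P K) 0 => (((F.P K).eta (k + 1))⁻¹ : ℂ) * (recordD F θ k K a l b i i' - (φ₀ b.tgt i i' - φ₀ b.src i i'))) =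
        fun b => (((F.P K).eta (k + 1))⁻¹ : ℂ) *
          (chartRespD F θ k K U a l b i i' - ((φ₀ b.tgt i i' + ψ b.tgt i i') - (φ₀ b.src i i' + ψ b.src i i'))) := by
    intro φ₀ i i'
    funext b
    rw [hψ b i i']
    ring
  constructor
  · rintro ⟨φ₀, h⟩
    refine ⟨fun x i i' => φ₀ x i i' + ψ x i i', fun hk i i' => ?_⟩
    have h' := h hk i i'
    rw [key φ₀ i i'] at h'
    exact h'
  · rintro ⟨φ₀, h⟩
    refine ⟨fun x i i' => φ₀ x i i' - ψ x i i', fun hk i i' => ?_⟩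
    have h' := h hk i i'
    have e1 : (fun b : PBond (F.P K) 0 => (((F.P K).eta (k + 1))⁻¹ : ℂ) * (recordD F θ k K a l b i i' -
        ((fun x i i' => φ₀ x i i' - ψ x i i') b.tgt i i' - (fun x i i' => φ₀ x i i' - ψ x i i') b.src i i'))) =
        fun b => (((F.P K).eta (k + 1))⁻¹ : ℂ) * (chartRespD F θ k K U a l b i i' - (φ₀ b.tgt i i' - φ₀ b.src i i')) := by
      funext b
      simp only []
      rw [hψ b i i']
      ring
    rw [e1]
    exact h'

/-- ★★★ **THE JUNCTION SOCKET**: if the CHART response itself is weakly critical (`φ₀ = 0` at chart level), then the rooted table satisfies (C-wcg) — with the unrestricted potential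
THE ROOTING POTENTIAL `ψ`, computed. [cite: Balaban1985Variational, (176)–(178) p.306, (19) p.281, (21) p.281; Balaban1984PropagatorsII, (2.35) p.228; Balaban1987RG1, (4.35) p.290] -/
theorem criticalModGauge_of_chart_weaklyCritical (k K : ℕ) (U : (Fin (F.P K).d → Site (F.P K) (k + 1) → θ.Vβ) → GaugeField (F.P K) 0 (SU 2))
    (hfac : RootFactorAt F θ k K U) (hreg : ChartRegAt F θ k K U) (a : θ.ιβ) (l : RespLabel F k K)
    (hwc : ChartResponseWeaklyCriticalAt F θ k K U a l) : RootedResponseCriticalModGaugeAt F θ k K a l := by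
  letI := θ.instVβ₁; letI := θ.instVβ₂
  refine (criticalModGauge_iff_chart F θ k K U hfac hreg a l).2 ⟨fun _ _ _ => 0, fun hk i i' => ?_⟩
  simpa only [sub_self, sub_zero] using hwc hk i i'

/-- ★★★ **(C-orb) FROM the chart-level letter** (✓`rootedResponseOrbitAt_of_criticalModGauge`). [cite: Balaban1985Variational, (176)–(178) p.306; Balaban1984PropagatorsII, (2.35) p.228] -/
theorem rootedResponseOrbitAt_of_chart_weaklyCritical (k K : ℕ) (hk : k + 1 ≤ (F.P K).m + (F.P K).K)
    (U : (Fin (F.P K).d → Site (F.P K) (k + 1) → θ.Vβ) → GaugeField (F.P K) 0 (SU 2))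
    (hfac : RootFactorAt F θ k K U) (hreg : ChartRegAt F θ k K U) (a : θ.ιβ) (l : RespLabel F k K)
    (hwc : ChartResponseWeaklyCriticalAt F θ k K U a l) : RootedResponseOrbitAt F θ k K a l :=
  rootedResponseOrbitAt_of_criticalModGauge F θ k K hk a l (criticalModGauge_of_chart_weaklyCritical F θ k K U hfac hreg a l hwc)

/-- ★★★ **(C-crit) ∧ (C-cons) FROM the chart-level letter** (✓`criticalModGauge_iff_invCritical_and_constraintModGauge`). [cite: Balaban1985Variational, (176)–(178) p.306, (20) p.281; Balaban1984PropagatorsII, (2.5)–(2.8) p.224] -/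
theorem invCritical_and_constraintModGauge_of_chart_weaklyCritical (k K : ℕ)
    (U : (Fin (F.P K).d → Site (F.P K) (k + 1) → θ.Vβ) → GaugeField (F.P K) 0 (SU 2))
    (hfac : RootFactorAt F θ k K U) (hreg : ChartRegAt F θ k K U) (a : θ.ιβ) (l : RespLabel F k K)
    (hwc : ChartResponseWeaklyCriticalAt F θ k K U a l) :
    RootedResponseInvCriticalAt F θ k K a l ∧ RootedResponseConstraintModGaugeAt F θ k K a l :=
  (criticalModGauge_iff_invCritical_and_constraintModGauge F θ k K a l).1
    (criticalModGauge_of_chart_weaklyCritical F θ k K U hfac hreg a l hwc)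

/-- ★★★ **THE FOUR ROOTED RECEIPTS FROM CHART-LEVEL LETTERS** (any chart): factorisation + chart regularity + weak criticality of the chart response ⟹
(C-wcg) ∧ (C-orb) ∧ (C-crit) ∧ (C-cons) on `k + 1 ≤ m + K`. CONDITIONAL; every letter DISPLAYED. [cite: Balaban1985Variational, (176)–(178) p.306, (19) p.281; Balaban1984PropagatorsII, (2.35) p.228; Balaban1987RG1, (4.35) p.290] -/
theorem rootedReceipts_of_chart (k K : ℕ) (hk : k + 1 ≤ (F.P K).m + (F.P K).K)
    (U : (Fin (F.P K).d → Site (F.P K) (k + 1) → θ.Vβ) → GaugeField (F.P K) 0 (SU 2))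
    (hfac : RootFactorAt F θ k K U) (hreg : ChartRegAt F θ k K U) (a : θ.ιβ) (l : RespLabel F k K)
    (hwc : ChartResponseWeaklyCriticalAt F θ k K U a l) :
    RootedResponseCriticalModGaugeAt F θ k K a l ∧ RootedResponseOrbitAt F θ k K a l ∧
      RootedResponseInvCriticalAt F θ k K a l ∧ RootedResponseConstraintModGaugeAt F θ k K a l :=
  have hw := criticalModGauge_of_chart_weaklyCritical F θ k K U hfac hreg a l hwc
  ⟨hw, rootedResponseOrbitAt_of_criticalModGauge F θ k K hk a l hw,
    (criticalModGauge_iff_invCritical_and_constraintModGauge F θ k K a l).1 hw⟩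

end Summit.QuantumFields.YangMills.Theorems.K0AxCtabUniq

end
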